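import Summits.BirchSwinnertonDyer.Rank1Residual.Additive.DefectCountSignedSelmer
import Summits.BirchSwinnertonDyer.Rank1Residual.Additive.SignedSelmerLevelBridgeRat
import Summits.BirchSwinnertonDyer.Rank1Residual.Additive.AdicIntegersQuotientPrimePowCard
import Summits.BirchSwinnertonDyer.Rank1Residual.Additive.StrictSelmerDominatesShaAlgebra
import Literature.NumberTheory.GaloisCohomology.PoitouTateSelmerStructuresRealPlaces
import HarnessLib

/-!
# THE COUNT (C) FOR `A₀/S₀` OVER `ℚ` FOR THE `p*`-TWIST: `#(𝓞_{v₀}/p^m) = p^m`, `E(Ē)[p^∞]^{Γ_E} = 0`,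
# (loc)'s "no `p`-torsion in `W(ℚ_{v₀})`" and the divisibility of `E(K̄)` DISCHARGED — files 70, 76, 77
# composed (cell `b2b-bsdres`, CLASS-CLOSURE lane, class O10 — x1b GEN 38, class lead; file 78 of the
# series)

HONEST FRAMING (cell `b2b-bsdres`, run/shared/lean/b2b/bsd-rank1-residual/, verbatim in every
file): the goal of the cell is to DELETE the COMBINATION-SHAPED residual classes of the
Birch–Swinnerton-Dyer formula for ALL analytic-rank `≤ 1` elliptic curves over `ℚ` — "full BSD
formula for every rank `≤ 1` curve in class `C`" assembled STRICTLY from published theorems — so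
that the rank-`≤ 1` remainder becomes exactly the CONSTRUCTION-SHAPED classes, which are TYPED
(missing-input `Prop`s), NOT attempted. This is not "finishing BSD". CLASS-CLOSURE lane: prove
what is provable now; shrink each hard class to its core with data; no claim beyond stated classes;
research routes on CONSTRUCTION-SHAPED X12 / O10; census / instrument output = EVIDENCE / conjecture
items, NEVER a Literature fact; `RESIDUAL-MAP.md` marks change only by signed lines. THIS FILE:
TOOL THEOREMS ONLY — no definition, no named Literature fact, no Summits-side fact `def … : Prop`,
no `sorry`, axioms standard; CONDITIONAL on the NAMED FACTS `poitouTate_selmerStructure_duality_real ℚ`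
(taken as a hypothesis `hPT`; Milne I Thm. 4.10(b)) and `localEulerPoincareCharacteristic` (hypothesis
`hEP`; Milne I Thm. 2.8), on the
B3-shaped input `𝓣_{v₀} ⊓ L = p^t·C`, and the standing rank-one inputs (MW), (Ш), (Γ), (loc: exact
level `ν`), (span), (kill); nothing is booked; no label / mark / count / sub-cell moves; (C1_η),
(C2_η-GZ), (C3_η) stay typed as filed (cc-typer-6's pen); O10 stays OPEN / CONSTRUCTION-SHAPED;
nothing about `BSD(W, p)` of any pair is claimed.

## What

* §1 `eq_zero_of_smul_eq_zero_point_of_localFixedPoints` — (loc)'s first clause "no `p`-torsion in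
  `W(F)`" (Mathlib's points over a `K`-field `F`, e.g. `F = K_{v₀}`) FOLLOWS from the (htors) of files
  49/55/59 at any `K`-field `E` receiving a `K`-algebra map `F → E`: `W(F) ↪ W(E) ↪ E(Ē)` lands in the
  `Γ_E`-fixed points (`StrictSha.smul_eq_of_map_eq`), hence in the fixed points of every `H_E`.
* §2 `relIndex_strictSignedSelmerLayer_localPreimage_mul_prime_pow_eq_of_quadraticTwist_signedPrime` —
  file 77 over `ℚ` for the `p*`-TWIST `W` of a globally minimal good `a_p = 0` curve `V` (`p ≠ 2`),
  `E = ℚ_[p]`, `v₀` the place above `p` (`ℚ_{v₀} ⇄ ℚ_[p]` by Mathlib's `Padic.adicCompletionEquiv` inside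
  the proof): `#(𝓞_{v₀}/p^m) = p^m` (file 70), `E(Ē)[p^∞]^{Γ_E} = 0` and "no `p`-torsion in `W(ℚ_{v₀})`"
  (file 55 via file 76 §1 and §1 here), `E(K̄)` divisible, `p^m A₀ = 0` from `#A₀ ∣ p^m` — DISCHARGED:
  **`[A₀ : S₀] · p^{m−t−ν} = #(p^t·C) · ∏_{ℓ ∈ T} [𝓣_ℓ : 𝓚_ℓ]`** modulo exactly: the Poitou–Tate family,
  the local Euler characteristic, the tower structure `𝓣` and `𝒦_{v,0}[p^∞] = 0` off `T ∪ {v₀}`, the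
  B3-shaped `𝓣_{v₀} ⊓ L = p^t·C` with `C ⊔ 𝓚_{v₀} = ⊤`, `#A₀ ∣ p^m`, (MW), (Ш), (Γ), the exact level `ν` of
  `P` in `W(ℚ_{v₀})`, (kill), `ν + e ≤ t ≤ m − ν`.

References: [GreenbergLNM1716] §3–§4; [Kobayashi2003] Def. 2.1, Prop. 8.7, Thm. 9.3; [MilneADT2006] I;
[Howard2004HeegnerKolyvagin] Thm. 2.1.11; [SilvermanAEC2009] VIII.§1–2.
-/

noncomputable section

open scoped Classical

open CategoryTheory Field Function NumberField IsDedekindDomain WeierstrassCurve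
open Literature.NumberTheory.EllipticCurves
open Literature.NumberTheory.GaloisRepresentations
open Literature.NumberTheory.GaloisRepresentations.DiscreteGaloisModule (SelmerStructure)
open Literature.NumberTheory.GaloisCohomology
open Literature.NumberTheory.EllipticCurves.Kobayashi2003
open Summit.BirchSwinnertonDyer.Rank1Residual.X11b.Levels
open Summit.BirchSwinnertonDyer.Rank1Residual.X11b
open Summit.BirchSwinnertonDyer.Rank1Residual.Additive.DefectCountFiniteLevel
open scoped ContRepresentation

-- Over `ℚ` two `ℚ`-algebra structures on a completion are in scope (`DivisionRing.toRatAlgebra` and the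
-- completion's own); the tree's general-`K` statements (files 69, 77: `Place.instAlgebraCompletion`,
-- which unfolds to the latter) must be met by the latter, so it is preferred locally (this file only).
attribute [local instance 10000] IsDedekindDomain.HeightOneSpectrum.instAlgebraAdicCompletion
  NumberField.Place.instAlgebraCompletion

namespace Summit.BirchSwinnertonDyer.Rank1Residual.Additive.LevelBridge

universe u

/-! ### §1 No `p`-torsion in `W(F)` from (htors) at a `K`-field `E ⊇ F` -/

section Points

variable {K : Type u} [Field K] (W : WeierstrassCurve K) (p : ℕ)
  (F : Type u) [Field F] [Algebra K F] (E : Type u) [Field E] [Algebra K E]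

/-- **(htors) at `E` ⟹ no `p`-power torsion in `W(F)`** for a `K`-algebra map `f : F → E`: a point
`X ∈ W(F)` with `p^j • X = 0` maps (injectively, `Affine.Point.map_injective`) to
`W(F) → W(E) → E(Ē) = localPoints W E`, where it is fixed by `Γ_E` (`StrictSha.smul_eq_of_map_eq`), so
by every local subgroup `H_E`; (htors) kills it. With `F = K_{v₀}`, `E = ℚ_[p]` this is the first clause
of (loc) in files 68–70, 77. [cite: Kobayashi2003, Prop. 8.7 (p. 16)] [cite: SilvermanAEC2009, VIII.§1] -/
theorem eq_zero_of_smul_eq_zero_point_of_localFixedPoints (f : F →ₐ[K] E)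
    (H : Subgroup (absoluteGaloisGroup K))
    (htors : ∀ P : localPoints W E, P ∈ localFixedPointsOfEmb (closureEmb (K := K) E) W H →
      (∃ j : ℕ, p ^ j • P = 0) → P = 0)
    {j : ℕ} (X : (W.baseChange F).toAffine.Point) (hX : p ^ j • X = 0) : X = 0 := by
  set Y : (W.baseChange E).toAffine.Point := Affine.Point.map (W' := W) f X with hY
  set Z : localPoints W E :=
    Affine.Point.map (W' := W) (IsScalarTower.toAlgHom K E (AlgebraicClosure E)) Y with hZ
  have hfix : Z ∈ localFixedPointsOfEmb (closureEmb (K := K) E) W H := by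
    rw [mem_localFixedPointsOfEmb_iff]
    intro τ _
    exact StrictSha.smul_eq_of_map_eq W E τ Y hZ.symm
  have hjY : p ^ j • Y = 0 := by rw [hY, ← map_nsmul, hX, map_zero]
  have hjZ : p ^ j • Affine.Point.map (W' := W) (IsScalarTower.toAlgHom K E (AlgebraicClosure E)) Y = 0 := by
    rw [← map_nsmul, hjY, map_zero]
  have hZ0 : Z = 0 := htors Z hfix ⟨j, hjZ⟩
  have hY0 : Y = 0 :=
    Affine.Point.map_injective (W' := W) (f := IsScalarTower.toAlgHom K E (AlgebraicClosure E))
      (hZ0.trans (map_zero _).symm)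
  exact Affine.Point.map_injective (W' := W) (f := f) (hY0.trans (map_zero _).symm)

end Points

/-! ### §2 Over `ℚ` for the `p*`-twist of a good supersingular curve -/

section Twist

variable (W : WeierstrassCurve ℚ) [W.IsElliptic] {p : ℕ} [hp : Fact p.Prime] (κ : ZpExtension ℚ p)
  {m : ℕ}

/-- **THE COUNT (C) FOR `A₀/S₀` OF THE `p*`-TWIST — `[A₀ : S₀]·p^{m−t−ν} = #(p^t·C)·∏_{ℓ∈T}[𝓣_ℓ : 𝓚_ℓ]`
with `#(𝓞_{v₀}/p^m) = p^m`, `E(Ē)[p^∞]^{Γ_E} = 0`, "no `p`-torsion in `W(ℚ_{v₀})`", the divisibility of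
`E(K̄)` and `p^m A₀ = 0` (from `#A₀ ∣ p^m`) DISCHARGED** (`W` the `(−1)^{p/2}p`-twist of a globally minimal
`V` good at `p` with `a_p(V) = 0`, `p ≠ 2`; `E = ℚ_[p]`, `v₀` the place above `p`).  Remaining hypotheses
(exactly): the NAMED FACTS `poitouTate_selmerStructure_duality_real ℚ` (Milne I 4.10 with the real
place; CONDITIONAL) and Tate's local Euler characteristic `localEulerPoincareCharacteristic` at the
finite places (Milne I 2.8; CONDITIONAL); the tower structure `𝓣` on `W[p^m]` and `𝒦_{v,0}[p^∞] = 0` off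
`T ∪ {v₀}`; the B3-shaped `𝓣_{v₀} ⊓ loc_{v₀}(Ψ_m⁻¹A₀) = p^t·C` with `C ⊔ 𝓚_{v₀} = ⊤`; `#A₀ ∣ p^m`; (MW) `P`
generates `W(ℚ)/p^m` with order `p^m` (group law with Mathlib's `instDecidableEqRat`); (Ш) `Ш[p^m] ⊆
Ш[p^e]`; (Γ) `W[p^∞]^{Γ_ℚ} = 0`; the exact level `ν` of `P` in `W(ℚ_{v₀})`; (kill); `ν + e ≤ t`, `t + ν ≤ m`.
Nothing about (C1_η), (C2_η-GZ), (C3_η), B3 or `BSD(W, p)` is claimed.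
[cite: GreenbergLNM1716, §4 (pp. 98–103)] [cite: Kobayashi2003, Prop. 8.7 (p. 16), Def. 2.1 (p. 5), Thm. 9.3 (p. 26)]
[cite: MilneADT2006, Ch. I, Thm. 2.8, Lemma 3.3 and Thm. 4.10] -/
theorem relIndex_strictSignedSelmerLayer_localPreimage_mul_prime_pow_eq_of_quadraticTwist_signedPrime
    (hm : 1 ≤ m) (hp2 : p ≠ 2) (Cv : VariableChange ℚ) (V : WeierstrassCurve ℚ) [V.IsElliptic]
    [V.IsGloballyMinimal] (hCV : Cv • W.quadraticTwist ((-1) ^ (p / 2) * p) = V)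
    (hgood : V.HasGoodReductionAtPrime p) (hap : V.frobeniusTrace p = 0)
    -- the two fact-shaped inputs: Poitou–Tate duality with the real place, Tate's local Euler characteristic
    (hPT : poitouTate_selmerStructure_duality_real ℚ)
    (hEP : ∀ v : HeightOneSpectrum (𝓞 ℚ), localEulerPoincareCharacteristic (v.adicCompletion ℚ))
    (v₀ : HeightOneSpectrum (𝓞 ℚ)) (hv₀ : (Rat.HeightOneSpectrum.primesEquiv (R := 𝓞 ℚ)).symm ⟨p, hp.out⟩ = v₀)
    (T : Finset (HeightOneSpectrum (𝓞 ℚ))) (hv₀T : v₀ ∉ T)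
    (𝓣 : SelmerStructure (W.torsionGaloisModule ((p ^ m : ℕ) : ℤ)))
    (h𝓣fin : ∀ v : HeightOneSpectrum (𝓞 ℚ), 𝓣 (Sum.inr v) =
      (W.localTowerKer κ (v.adicCompletion ℚ) 0).comap
        ((resH1Hom (Literature.NumberTheory.EllipticCurves.subgroupIncl
            (localSubgroup (κ.layerSubgroup 0) (v.adicCompletion ℚ)))
          (AddMonoidHom.id (localPoints W (v.adicCompletion ℚ))) (fun _ _ ↦ rfl)).comp
          (galoisCohomology.map
            (W.torsionPointsMapIntertwining ((p ^ m : ℕ) : ℤ) (v.adicCompletion ℚ)) 1)))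
    (h𝓣inf : ∀ w : InfinitePlace ℚ, 𝓣 (Sum.inl w) = W.kummerSelmerStructure ((p ^ m : ℕ) : ℤ) (Sum.inl w))
    (hT0 : ∀ v : HeightOneSpectrum (𝓞 ℚ), v ∉ T →
      v ≠ v₀ → W.localTowerKerPrimary κ (v.adicCompletion ℚ) 0 = ⊥)
    (C : AddSubgroup (galoisCohomology ((W.torsionGaloisModule ((p ^ m : ℕ) : ℤ)).toLocal
      (Sum.inr v₀)) 1))
    {t ν eSha : ℕ}
    (hC : 𝓣 (Sum.inr v₀) ⊓
        ((((W.selmerInfty κ ⊓ ⨅ σ : absoluteGaloisGroup ℚ,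
            (localKummerOverOfEmb W p κ.kerSubgroup (closureEmb (K := ℚ) ℚ_[p])
              (⨆ n, strictSignedLocalPoints κ ℚ_[p] W (-1) n)).comap
                (W.conjH1 p κ.kerSubgroup σ)).comap (W.layerToInfty κ 0)).comap
          ((resH1Hom (Literature.NumberTheory.EllipticCurves.subgroupIncl (κ.layerSubgroup 0)) (AddMonoidHom.id (geomPrimaryTorsion W p))
            (fun _ _ ↦ rfl)).comp (galoisCohomology.map (primaryInclusion W p m) 1))).map
          (galoisCohomology.localization (W.torsionGaloisModule ((p ^ m : ℕ) : ℤ)) (Sum.inr v₀) 1)) =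
      C.map (nsmulAddMonoidHom (p ^ t)))
    (hcard : Nat.card ↥((W.selmerInfty κ ⊓ ⨅ σ : absoluteGaloisGroup ℚ,
        (localKummerOverOfEmb W p κ.kerSubgroup (closureEmb (K := ℚ) ℚ_[p])
          (⨆ n, strictSignedLocalPoints κ ℚ_[p] W (-1) n)).comap
            (W.conjH1 p κ.kerSubgroup σ)).comap (W.layerToInfty κ 0)) ∣ p ^ m)
    -- (MW)
    (P : W.toAffine.Point)
    (hgen : ∀ Q : W.toAffine.Point, ∃ a : ℤ,
      Q - a • P ∈ (zsmulAddGroupHom ((p ^ m : ℕ) : ℤ) : W.toAffine.Point →+ _).range)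
    (hord : ∀ a : ℤ, a • P ∈ (zsmulAddGroupHom ((p ^ m : ℕ) : ℤ) : W.toAffine.Point →+ _).range →
      ((p ^ m : ℕ) : ℤ) ∣ a)
    -- (Ш)
    (hSha : ∀ c ∈ W.sha, ((p ^ m : ℕ) : ℤ) • c = 0 → p ^ eSha • c = 0)
    -- (Γ)
    (hΓ : ∀ Q : W.geomPrimaryTorsion p,
      (∀ σ : absoluteGaloisGroup ℚ, X11b.LocBridge.primaryGaloisModule W p σ Q = Q) → Q = 0)
    -- (loc): the exact level `ν` of `P` at `v₀`
    {Qv : (W.baseChange (v₀.adicCompletion ℚ)).toAffine.Point}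
    (hPQ : p ^ ν • Qv = Affine.Point.baseChange (W' := W) ℚ (v₀.adicCompletion ℚ) P)
    (hexact : ∀ Q' : (W.baseChange (v₀.adicCompletion ℚ)).toAffine.Point,
      p ^ (ν + 1) • Q' ≠ Affine.Point.baseChange (W' := W) ℚ (v₀.adicCompletion ℚ) P)
    -- (span) at `v₀`
    (hCL : C ⊔ W.kummerSelmerStructure ((p ^ m : ℕ) : ℤ)
      (Sum.inr v₀) = ⊤)
    -- (kill) at `ℓ ∈ T`
    (hkill : ∀ w ∈ T, ∀ x ∈ W.kummerSelmerStructure ((p ^ m : ℕ) : ℤ) (Sum.inr w),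
      p ^ (m - t - ν) • x = 0)
    (het : ν + eSha ≤ t) (htν : t + ν ≤ m) :
    (strictSignedSelmerLayer W κ ℚ_[p] (-1) 0).relIndex
        ((W.selmerInfty κ ⊓ ⨅ σ : absoluteGaloisGroup ℚ,
          (localKummerOverOfEmb W p κ.kerSubgroup (closureEmb (K := ℚ) ℚ_[p])
            (⨆ n, strictSignedLocalPoints κ ℚ_[p] W (-1) n)).comap
              (W.conjH1 p κ.kerSubgroup σ)).comap (W.layerToInfty κ 0)) * p ^ (m - t - ν) =
      Nat.card (C.map (nsmulAddMonoidHom (p ^ t))) *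
        ∏ w ∈ T, (W.kummerSelmerStructure ((p ^ m : ℕ) : ℤ) (Sum.inr w)).relIndex (𝓣 (Sum.inr w)) := by
  haveI : NeZero (p ^ m) := ⟨pow_ne_zero m hp.out.ne_zero⟩
  obtain ⟨inv, hperf, hvan, -, hcomp, hreal⟩ := exists_localInvariants_injective_inl_of_real hPT (p ^ m)
  have hvp : (Rat.HeightOneSpectrum.primesEquiv v₀ : ℕ) = p := by
    rw [← hv₀, Equiv.apply_symm_apply]
  -- the model `ℚ_[p]` of `ℚ_{v₀}` (Mathlib's `Padic.adicCompletionEquiv`, transported along `hv₀`)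
  obtain ⟨e⟩ : Nonempty (ℚ_[p] ≃A[ℚ] v₀.adicCompletion ℚ) := by
    subst hv₀
    exact ⟨Padic.adicCompletionEquiv (𝓞 ℚ) ⟨p, hp.out⟩⟩
  letI : Algebra (v₀.adicCompletion ℚ) ℚ_[p] :=
    ((e.symm : v₀.adicCompletion ℚ ≃A[ℚ] ℚ_[p]) : v₀.adicCompletion ℚ →ₐ[ℚ] ℚ_[p]).toRingHom.toAlgebra
  haveI : IsScalarTower ℚ (v₀.adicCompletion ℚ) ℚ_[p] :=
    IsScalarTower.of_algebraMap_eq fun q ↦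
      (((e.symm : v₀.adicCompletion ℚ ≃A[ℚ] ℚ_[p]) : v₀.adicCompletion ℚ →ₐ[ℚ] ℚ_[p]).commutes q).symm
  letI : Algebra ℚ_[p] (v₀.adicCompletion ℚ) :=
    ((e : ℚ_[p] ≃A[ℚ] v₀.adicCompletion ℚ) : ℚ_[p] →ₐ[ℚ] v₀.adicCompletion ℚ).toRingHom.toAlgebra
  haveI : IsScalarTower ℚ ℚ_[p] (v₀.adicCompletion ℚ) :=
    IsScalarTower.of_algebraMap_eq fun q ↦
      (((e : ℚ_[p] ≃A[ℚ] v₀.adicCompletion ℚ) : ℚ_[p] →ₐ[ℚ] v₀.adicCompletion ℚ).commutes q).symm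
  haveI : CharZero (Place.Completion (Sum.inr v₀ : Place ℚ)) :=
    Literature.NumberTheory.GaloisRepresentations.charZero_adicCompletion v₀
  -- (htors) for the twist (file 55)
  obtain ⟨M, hΔ, hA, hVM⟩ := exists_goodSupersingularPadicModel hp2 V hgood hap
  have hc := sq_ne_neg_one_pow_mul_prime hp.out (p / 2)
  have htorsE := eq_zero_of_prime_pow_smul_eq_zero_localFixedPointsOfEmb_kerSubgroup_of_quadraticTwist κ
    (closureEmb (K := ℚ) ℚ_[p]) hp2 W hc Cv hCV M hΔ hA hVM
  -- (loc)'s first clause in Mathlib's point model at `ℚ_{v₀}`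
  have htors : ∀ X : (W.baseChange (v₀.adicCompletion ℚ)).toAffine.Point,
      p • X = 0 → X = 0 := fun X hX ↦
    eq_zero_of_smul_eq_zero_point_of_localFixedPoints W p (v₀.adicCompletion ℚ) ℚ_[p]
      ((e.symm : v₀.adicCompletion ℚ ≃A[ℚ] ℚ_[p]) : v₀.adicCompletion ℚ →ₐ[ℚ] ℚ_[p]) κ.kerSubgroup htorsE
      (j := 1) X (by rwa [pow_one])
  -- `p^m A₀ = 0` from `#A₀ ∣ p^m`
  have hA₀ : ∀ z ∈ (W.selmerInfty κ ⊓ ⨅ σ : absoluteGaloisGroup ℚ,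
      (localKummerOverOfEmb W p κ.kerSubgroup (closureEmb (K := ℚ) ℚ_[p])
        (⨆ n, strictSignedLocalPoints κ ℚ_[p] W (-1) n)).comap
          (W.conjH1 p κ.kerSubgroup σ)).comap (W.layerToInfty κ 0), p ^ m • z = 0 := fun z hz ↦
    congrArg Subtype.val (addOrderOf_dvd_iff_nsmul_eq_zero.mp ((addOrderOf_dvd_natCard
      (⟨z, hz⟩ : ↥((W.selmerInfty κ ⊓ ⨅ σ : absoluteGaloisGroup ℚ,
        (localKummerOverOfEmb W p κ.kerSubgroup (closureEmb (K := ℚ) ℚ_[p])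
          (⨆ n, strictSignedLocalPoints κ ℚ_[p] W (-1) n)).comap
            (W.conjH1 p κ.kerSubgroup σ)).comap (W.layerToInfty κ 0)))).trans hcard))
  -- the general-`K` file 69 / 77 carry the classical `DecidableEq ℚ` in the group law of `W(ℚ)`
  have hinst : (instDecidableEqRat : DecidableEq ℚ) = fun a b => Classical.propDecidable (a = b) :=
    Subsingleton.elim _ _
  rw [hinst] at hgen hord
  exact relIndex_strictSignedSelmerLayer_localPreimage_mul_prime_pow_eq W κ hm inv hperf hvan hcomp
    hreal hEP v₀ (natCard_quot_adicCompletionIntegers_prime_pow_rat hvp m) ℚ_[p]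
    (forall_fixed_eq_zero_of_localFixedPoints W p ℚ_[p] κ.kerSubgroup htorsE) T hv₀T 𝓣 h𝓣fin h𝓣inf
    hT0 C hC hA₀ (zsmul_geomPoints_surjective_holds W) P hgen hord hSha hΓ htors hPQ hexact hCL hkill
    het htν

end Twist

end Summit.BirchSwinnertonDyer.Rank1Residual.Additive.LevelBridge

end
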